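import Summits.KontsevichZagierPeriods.KontsevichZagierPeriods.Theorems.RootDecompRationalCubeDichotomyEtaleResidueForm

/-!
# Route RootDecompRationalCubeDichotomy — items 29429 `PiRationalisationEtale` / 29431 `PiRationalisationGlue` PROVED, part 2/8: the intermediate statements of the weighted chain (`RootIsolationE`, `BoxChainE`, `GreenReductionE`, `OuterGreenE`, `InnerResidueE`, `OuterInSectorE`) and the box-to-cube substitution `xSubst` with its two transport lemmas (`RootDecompRationalCubeDichotomyEtaleStatements`)

Theorems-split (≤ 400 lines each, sequential imports) of the decomp-kz lens-2 gen-5 file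
`run/shared/lean/pub/decomp-kz/decomp-kz-lens-2/g5/PiRationalisationEtale.lean` (sha256 204f4992…, 2557 lines; lens farm rc 0 / 0 sorry /
std axioms; critic decomp-kz-crit-1 g2 CLEARED/CONFIRMED 2026-08-30T06:50:50Z «29429 + 29431 proved BY NAME»), landed by the census seat
decomp-kz-census-1 g6 with the 86 verbatim copies of already-landed declarations REMOVED in favour of `import`/`open` of the landed
`Rung27842.ReIm` / `Rung27842.SimpleBranch` / `Rung24903` chain (`ratCubeSet`, `piIter_mem_sup`, `RatBoxSet`, `BoxRescale`, `boxRescale_holds`,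
the Re–Im polynomial calculus, the Green assembly kit, the S3/S1 lemmas), so that only the NEW weighted (étale) content is declared here.
The rung: for WEIGHTED simple-branch (standard-étale) data `[Π[loᵢ,hiᵢ], A(x,h x)/B(x,h x)]` (`F(x,h) = 0`, `∂_w F(x,h) ≠ 0`, `B(x,h) ≠ 0` on the
closed box, `F A B ∈ ℚ[x,w]`, `h` ℚ-Nash near the box) `[π]^K·[s] ∈ relations ⊔ ⟨rational closed-cube sector⟩` for every `K ≥ 1` — the gen-4
argument-principle chain with the contour form `ω = A·F_w/(B·F) dw`, whose residue at the simple real root is `A/B = s.integrand`.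
[Kontsevich–Zagier 2001 §1.2; argument principle] Standard axioms, 0 sorry.
-/

noncomputable section

set_option linter.dupNamespace false

namespace Summit.KontsevichZagierPeriods.RootDecompRationalCubeDichotomy.RungEtale.Etale

open MeasureTheory Set MvPolynomial
open Literature.NumberTheory.Transcendental Literature.NumberTheory.Transcendental.KZ
open Literature.ModelTheory.ExponentialFields (IsSemialgebraic analyticOnNhd_aeval continuous_aeval_real)
open Summit.KontsevichZagierPeriods.KontsevichZagierPeriods.Theses.RootDecompRationalCubeDichotomy
open Summit.KontsevichZagierPeriods.RootDecompRationalCubeDichotomy.Rung24903 (of_sub_of_mem_relations_of_fibreMap)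
open Summit.KontsevichZagierPeriods.RootDecompRationalCubeDichotomy.Rung27842
open Summit.KontsevichZagierPeriods.RootDecompRationalCubeDichotomy.Rung27842.RootIso
open Summit.KontsevichZagierPeriods.RootDecompRationalCubeDichotomy.Rung27842.SimpleBranch
open Summit.KontsevichZagierPeriods.RootDecompRationalCubeDichotomy.Rung24903
  (piRep_mul_mem_sup_of_mem_closure piRep_mul_mem_sup piIter_mem_sup isSemialgebraic_cubeLit)

/-- Statement A-E (root isolation + subdivision for a simple real branch `g` of `D`; the integrand is carried along). -/
def RootIsolationE : Prop :=
  ∀ (n : ℕ) (g : (Fin n → ℝ) → ℝ) (U : Set (Fin n → ℝ)) (s : IntegralRep n)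
    (D : MvPolynomial (Fin (n + 1)) ℚ),
    IsOpen U → Set.pi Set.univ (fun _ : Fin n => Set.Icc (0:ℝ) 1) ⊆ U →
    IsSemialgebraicFunOn ℚ U g → AnalyticOnNhd ℝ g U →
    (∀ x ∈ Set.pi Set.univ (fun _ : Fin n => Set.Icc (0:ℝ) 1),
      aeval (Fin.snoc x (g x) : Fin (n + 1) → ℝ) D = 0) →
    (∀ x ∈ Set.pi Set.univ (fun _ : Fin n => Set.Icc (0:ℝ) 1),
      aeval (Fin.snoc x (g x) : Fin (n + 1) → ℝ) (pderiv (Fin.last n) D) ≠ 0) →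
    s.domain = Set.pi Set.univ (fun _ : Fin n => Set.Icc (0:ℝ) 1) →
    ∃ (k : ℕ) (lo hi : Fin k → Fin n → ℚ) (piece : Fin k → IntegralRep n) (a b c ε : Fin k → ℚ),
      (∀ j i, lo j i < hi j i) ∧
      (∀ j, (piece j).domain = Set.pi Set.univ (fun i : Fin n => Set.Icc ((lo j i : ℚ) : ℝ) (hi j i))) ∧
      (∀ j, (piece j).domain ⊆ Set.pi Set.univ (fun _ : Fin n => Set.Icc (0:ℝ) 1)) ∧
      (∀ j, ∀ z ∈ (piece j).domain, (piece j).integrand z = s.integrand z) ∧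
      of s - ∑ j, of (piece j) ∈ relations ∧
      (∀ j, (a j < b j ∧ 0 < ε j ∧ ε j < c j ∧ (∀ x ∈ (piece j).domain, ((a j : ℚ) : ℝ) + ((ε j : ℚ) : ℝ) < g x ∧ g x + ((ε j : ℚ) : ℝ) < ((b j : ℚ) : ℝ)) ∧ (∀ x ∈ (piece j).domain, ∀ z : ℂ, ((a j : ℚ) : ℝ) ≤ z.re → z.re ≤ ((b j : ℚ) : ℝ) → |z.im| ≤ ((c j : ℚ) : ℝ) → aeval (Fin.snoc (fun i => ((x i : ℝ) : ℂ)) z : Fin (n + 1) → ℂ) D = 0 → z = ((g x : ℝ) : ℂ))))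

/-- Statement B-E (the per-box chain with weight `A/B`, load-bearing). -/
def BoxChainE : Prop :=
  ∀ (n : ℕ) (g : (Fin n → ℝ) → ℝ) (U : Set (Fin n → ℝ)) (piece : IntegralRep n)
    (F A B : MvPolynomial (Fin (n + 1)) ℚ) (lo hi : Fin n → ℚ) (a b c ε : ℚ),
    IsOpen U → piece.domain ⊆ U → IsSemialgebraicFunOn ℚ U g → AnalyticOnNhd ℝ g U →
    (∀ i, lo i < hi i) →
    piece.domain = Set.pi Set.univ (fun i : Fin n => Set.Icc ((lo i : ℚ) : ℝ) (hi i)) →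
    (∀ x ∈ piece.domain, aeval (Fin.snoc x (g x) : Fin (n + 1) → ℝ) F = 0) →
    (∀ x ∈ piece.domain, aeval (Fin.snoc x (g x) : Fin (n + 1) → ℝ) (pderiv (Fin.last n) F) ≠ 0) →
    (∀ x ∈ piece.domain, aeval (Fin.snoc x (g x) : Fin (n + 1) → ℝ) B ≠ 0) →
    (∀ x ∈ piece.domain, piece.integrand x = aeval (Fin.snoc x (g x) : Fin (n + 1) → ℝ) A / aeval (Fin.snoc x (g x) : Fin (n + 1) → ℝ) B) →
    (a < b ∧ 0 < ε ∧ ε < c ∧ (∀ x ∈ piece.domain, ((a : ℚ) : ℝ) + ((ε : ℚ) : ℝ) < g x ∧ g x + ((ε : ℚ) : ℝ) < ((b : ℚ) : ℝ)) ∧ (∀ x ∈ piece.domain, ∀ z : ℂ, ((a : ℚ) : ℝ) ≤ z.re → z.re ≤ ((b : ℚ) : ℝ) → |z.im| ≤ ((c : ℚ) : ℝ) → aeval (Fin.snoc (fun i => ((x i : ℝ) : ℂ)) z : Fin (n + 1) → ℂ) (B * F) = 0 → z = ((g x : ℝ) : ℂ))) →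
    of piRep * of piece ∈ relations ⊔ AddSubgroup.closure ratCubeSet

/-- B1-E: Green reduction with weight. -/
def GreenReductionE : Prop :=
  ∀ (n : ℕ) (g : (Fin n → ℝ) → ℝ) (U : Set (Fin n → ℝ)) (piece : IntegralRep n)
    (F A B : MvPolynomial (Fin (n + 1)) ℚ) (lo hi : Fin n → ℚ) (a b c ε : ℚ),
    IsOpen U → piece.domain ⊆ U → IsSemialgebraicFunOn ℚ U g → AnalyticOnNhd ℝ g U →
    (∀ i, lo i < hi i) →
    piece.domain = Set.pi Set.univ (fun i : Fin n => Set.Icc ((lo i : ℚ) : ℝ) (hi i)) →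
    (∀ x ∈ piece.domain, aeval (Fin.snoc x (g x) : Fin (n + 1) → ℝ) F = 0) →
    (∀ x ∈ piece.domain, aeval (Fin.snoc x (g x) : Fin (n + 1) → ℝ) (pderiv (Fin.last n) F) ≠ 0) →
    (∀ x ∈ piece.domain, aeval (Fin.snoc x (g x) : Fin (n + 1) → ℝ) B ≠ 0) →
    (∀ x ∈ piece.domain, piece.integrand x = aeval (Fin.snoc x (g x) : Fin (n + 1) → ℝ) A / aeval (Fin.snoc x (g x) : Fin (n + 1) → ℝ) B) →
    (a < b ∧ 0 < ε ∧ ε < c ∧ (∀ x ∈ piece.domain, ((a : ℚ) : ℝ) + ((ε : ℚ) : ℝ) < g x ∧ g x + ((ε : ℚ) : ℝ) < ((b : ℚ) : ℝ)) ∧ (∀ x ∈ piece.domain, ∀ z : ℂ, ((a : ℚ) : ℝ) ≤ z.re → z.re ≤ ((b : ℚ) : ℝ) → |z.im| ≤ ((c : ℚ) : ℝ) → aeval (Fin.snoc (fun i => ((x i : ℝ) : ℂ)) z : Fin (n + 1) → ℂ) (B * F) = 0 → z = ((g x : ℝ) : ℂ))) →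
    ∃ (P₁ P₂ : IntegralRep (n + 1)),
      P₁.domain = KZlog.band piece.domain (fun _ => 0) (fun _ => (ε:ℝ)) ∧
      (∀ z ∈ P₁.domain,
        P₁.integrand z = 2 * piece.integrand (Fin.init z) * (ε:ℝ) / ((ε:ℝ) ^ 2 + z (Fin.last n) ^ 2)) ∧
      P₂.domain = KZlog.band piece.domain (fun x => g x - ε) (fun x => g x + ε) ∧
      (∀ z ∈ P₂.domain,
        P₂.integrand z = piece.integrand (Fin.init z) * (ε:ℝ) / ((z (Fin.last n) - g (Fin.init z)) ^ 2 + (ε:ℝ) ^ 2)) ∧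
      of P₁ + of P₂ ∈ relations ⊔ AddSubgroup.closure RatBoxSet

/-- S1-E: outer Green for a generic closed pair `(Im, Re)(N/D)`, `D` zero-free off the root in the rectangle. -/
def OuterGreenE : Prop :=
  ∀ (n : ℕ) (g : (Fin n → ℝ) → ℝ) (U : Set (Fin n → ℝ)) (piece : IntegralRep n)
    (N D : MvPolynomial (Fin (n + 1)) ℚ) (lo hi : Fin n → ℚ) (a b c ε : ℚ),
    IsOpen U → piece.domain ⊆ U → IsSemialgebraicFunOn ℚ U g → AnalyticOnNhd ℝ g U →
    (∀ i, lo i < hi i) →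
    piece.domain = Set.pi Set.univ (fun i : Fin n => Set.Icc ((lo i : ℚ) : ℝ) (hi i)) →
    (a < b ∧ 0 < ε ∧ ε < c ∧ (∀ x ∈ piece.domain, ((a : ℚ) : ℝ) + ((ε : ℚ) : ℝ) < g x ∧ g x + ((ε : ℚ) : ℝ) < ((b : ℚ) : ℝ)) ∧ (∀ x ∈ piece.domain, ∀ z : ℂ, ((a : ℚ) : ℝ) ≤ z.re → z.re ≤ ((b : ℚ) : ℝ) → |z.im| ≤ ((c : ℚ) : ℝ) → aeval (Fin.snoc (fun i => ((x i : ℝ) : ℂ)) z : Fin (n + 1) → ℂ) D = 0 → z = ((g x : ℝ) : ℂ))) →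
    ∃ (E1 E2 BQ BP : IntegralRep (n + 1)),
      (E1.domain = KZlog.band piece.domain (fun _ => 0) (fun _ => (ε:ℝ)) ∧ ∀ z ∈ E1.domain, E1.integrand z = ReIm.ratRe N D (Fin.snoc (Fin.snoc (Fin.init z) (g (Fin.init z) + (ε:ℝ)) : Fin (n + 1) → ℝ) (z (Fin.last n))) - ReIm.ratRe N D (Fin.snoc (Fin.snoc (Fin.init z) (g (Fin.init z) - (ε:ℝ)) : Fin (n + 1) → ℝ) (z (Fin.last n)))) ∧ (E2.domain = KZlog.band piece.domain (fun x => g x - ε) (fun x => g x + ε) ∧ ∀ z ∈ E2.domain, E2.integrand z = ReIm.ratIm N D (Fin.snoc z (ε:ℝ))) ∧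
      (BQ.domain = KZlog.band piece.domain (fun _ => 0) (fun _ => (c:ℝ)) ∧ ∀ z ∈ BQ.domain, BQ.integrand z = ReIm.ratRe N D (Fin.snoc (Fin.snoc (Fin.init z) (b:ℝ) : Fin (n + 1) → ℝ) (z (Fin.last n))) - ReIm.ratRe N D (Fin.snoc (Fin.snoc (Fin.init z) (a:ℝ) : Fin (n + 1) → ℝ) (z (Fin.last n)))) ∧ (BP.domain = KZlog.band piece.domain (fun _ => (a:ℝ)) (fun _ => (b:ℝ)) ∧ ∀ z ∈ BP.domain, BP.integrand z = ReIm.ratIm N D (Fin.snoc z (c:ℝ))) ∧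
      of E1 - of E2 - (of BQ - of BP) ∈ relations

/-- S2-E: inner residue with weight (`ω − φ(y)/(w−y)` regular on the closed inner square, `φ = A/B`). -/
def InnerResidueE : Prop :=
  ∀ (n : ℕ) (g : (Fin n → ℝ) → ℝ) (U : Set (Fin n → ℝ)) (piece : IntegralRep n)
    (F A B : MvPolynomial (Fin (n + 1)) ℚ) (lo hi : Fin n → ℚ) (a b c ε : ℚ),
    IsOpen U → piece.domain ⊆ U → IsSemialgebraicFunOn ℚ U g → AnalyticOnNhd ℝ g U →
    (∀ i, lo i < hi i) →
    piece.domain = Set.pi Set.univ (fun i : Fin n => Set.Icc ((lo i : ℚ) : ℝ) (hi i)) →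
    (∀ x ∈ piece.domain, aeval (Fin.snoc x (g x) : Fin (n + 1) → ℝ) F = 0) →
    (∀ x ∈ piece.domain, aeval (Fin.snoc x (g x) : Fin (n + 1) → ℝ) (pderiv (Fin.last n) F) ≠ 0) →
    (∀ x ∈ piece.domain, aeval (Fin.snoc x (g x) : Fin (n + 1) → ℝ) B ≠ 0) →
    (∀ x ∈ piece.domain, piece.integrand x = aeval (Fin.snoc x (g x) : Fin (n + 1) → ℝ) A / aeval (Fin.snoc x (g x) : Fin (n + 1) → ℝ) B) →
    (a < b ∧ 0 < ε ∧ ε < c ∧ (∀ x ∈ piece.domain, ((a : ℚ) : ℝ) + ((ε : ℚ) : ℝ) < g x ∧ g x + ((ε : ℚ) : ℝ) < ((b : ℚ) : ℝ)) ∧ (∀ x ∈ piece.domain, ∀ z : ℂ, ((a : ℚ) : ℝ) ≤ z.re → z.re ≤ ((b : ℚ) : ℝ) → |z.im| ≤ ((c : ℚ) : ℝ) → aeval (Fin.snoc (fun i => ((x i : ℝ) : ℂ)) z : Fin (n + 1) → ℂ) (B * F) = 0 → z = ((g x : ℝ) : ℂ))) →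
    ∃ (P₁ P₂ E1 E2 : IntegralRep (n + 1)),
      P₁.domain = KZlog.band piece.domain (fun _ => 0) (fun _ => (ε:ℝ)) ∧
      (∀ z ∈ P₁.domain,
        P₁.integrand z = 2 * piece.integrand (Fin.init z) * (ε:ℝ) / ((ε:ℝ) ^ 2 + z (Fin.last n) ^ 2)) ∧
      P₂.domain = KZlog.band piece.domain (fun x => g x - ε) (fun x => g x + ε) ∧
      (∀ z ∈ P₂.domain,
        P₂.integrand z = piece.integrand (Fin.init z) * (ε:ℝ) / ((z (Fin.last n) - g (Fin.init z)) ^ 2 + (ε:ℝ) ^ 2)) ∧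
      (E1.domain = KZlog.band piece.domain (fun _ => 0) (fun _ => (ε:ℝ)) ∧ ∀ z ∈ E1.domain, E1.integrand z = ReIm.ratRe (A * pderiv (Fin.last n) F) (B * F) (Fin.snoc (Fin.snoc (Fin.init z) (g (Fin.init z) + (ε:ℝ)) : Fin (n + 1) → ℝ) (z (Fin.last n))) - ReIm.ratRe (A * pderiv (Fin.last n) F) (B * F) (Fin.snoc (Fin.snoc (Fin.init z) (g (Fin.init z) - (ε:ℝ)) : Fin (n + 1) → ℝ) (z (Fin.last n)))) ∧ (E2.domain = KZlog.band piece.domain (fun x => g x - ε) (fun x => g x + ε) ∧ ∀ z ∈ E2.domain, E2.integrand z = ReIm.ratIm (A * pderiv (Fin.last n) F) (B * F) (Fin.snoc z (ε:ℝ))) ∧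
      of E1 - of E2 - (of P₁ + of P₂) ∈ relations

/-- S3-E: the outer edges lie in the rational-box sector (generic `(N, D)`). -/
def OuterInSectorE : Prop :=
  ∀ (n : ℕ) (g : (Fin n → ℝ) → ℝ) (U : Set (Fin n → ℝ)) (piece : IntegralRep n)
    (N D : MvPolynomial (Fin (n + 1)) ℚ) (lo hi : Fin n → ℚ) (a b c ε : ℚ),
    IsOpen U → piece.domain ⊆ U → IsSemialgebraicFunOn ℚ U g → AnalyticOnNhd ℝ g U →
    (∀ i, lo i < hi i) →
    piece.domain = Set.pi Set.univ (fun i : Fin n => Set.Icc ((lo i : ℚ) : ℝ) (hi i)) →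
    (a < b ∧ 0 < ε ∧ ε < c ∧ (∀ x ∈ piece.domain, ((a : ℚ) : ℝ) + ((ε : ℚ) : ℝ) < g x ∧ g x + ((ε : ℚ) : ℝ) < ((b : ℚ) : ℝ)) ∧ (∀ x ∈ piece.domain, ∀ z : ℂ, ((a : ℚ) : ℝ) ≤ z.re → z.re ≤ ((b : ℚ) : ℝ) → |z.im| ≤ ((c : ℚ) : ℝ) → aeval (Fin.snoc (fun i => ((x i : ℝ) : ℂ)) z : Fin (n + 1) → ℂ) D = 0 → z = ((g x : ℝ) : ℂ))) →
    ∀ (BQ BP : IntegralRep (n + 1)), (BQ.domain = KZlog.band piece.domain (fun _ => 0) (fun _ => (c:ℝ)) ∧ ∀ z ∈ BQ.domain, BQ.integrand z = ReIm.ratRe N D (Fin.snoc (Fin.snoc (Fin.init z) (b:ℝ) : Fin (n + 1) → ℝ) (z (Fin.last n))) - ReIm.ratRe N D (Fin.snoc (Fin.snoc (Fin.init z) (a:ℝ) : Fin (n + 1) → ℝ) (z (Fin.last n)))) → (BP.domain = KZlog.band piece.domain (fun _ => (a:ℝ)) (fun _ => (b:ℝ)) ∧ ∀ z ∈ BP.domain,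 BP.integrand z = ReIm.ratIm N D (Fin.snoc z (c:ℝ))) →
      of BQ ∈ RatBoxSet ∧ of BP ∈ RatBoxSet

/-- The affine substitution `xᵢ ↦ loᵢ + dᵢ·xᵢ` (`i < n`), `w ↦ w` on `ℚ[x₁,…,xₙ,w]`. -/
def xSubst (n : ℕ) (lo d : Fin n → ℚ) : Fin (n + 1) → MvPolynomial (Fin (n + 1)) ℚ :=
  Fin.snoc (fun i => C (lo i) + C (d i) * X (Fin.castSucc i)) (X (Fin.last n))

/-- Evaluation of the substituted polynomial = evaluation at the box point. -/
theorem aeval_bind₁_xSubst {n : ℕ} (lo d : Fin n → ℚ) (t : Fin n → ℝ) (w : ℝ) (P : MvPolynomial (Fin (n + 1)) ℚ) :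
    aeval (Fin.snoc t w : Fin (n + 1) → ℝ) (bind₁ (xSubst n lo d) P) =
      aeval (Fin.snoc (boxMap (fun j => (lo j : ℝ)) (fun j => (d j : ℝ)) t) w : Fin (n + 1) → ℝ) P := by
  rw [aeval_bind₁]
  have hpt : (fun i => aeval (Fin.snoc t w : Fin (n + 1) → ℝ) (xSubst n lo d i)) =
      (Fin.snoc (boxMap (fun j => (lo j : ℝ)) (fun j => (d j : ℝ)) t) w : Fin (n + 1) → ℝ) := by
    funext j
    refine Fin.lastCases ?_ (fun i => ?_) j
    · simp [xSubst]
    · simp [xSubst, boxMap, eq_ratCast]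
  rw [hpt]

/-- `∂_w` commutes with the substitution in the `x`-variables. -/
theorem pderiv_last_bind₁_xSubst {n : ℕ} (lo d : Fin n → ℚ) (P : MvPolynomial (Fin (n + 1)) ℚ) :
    pderiv (Fin.last n) (bind₁ (xSubst n lo d) P) = bind₁ (xSubst n lo d) (pderiv (Fin.last n) P) := by
  induction P using MvPolynomial.induction_on with
  | C a => simp
  | add p q hp hq => simp only [map_add, hp, hq]
  | mul_X p i hp =>
    have key : pderiv (Fin.last n) (xSubst n lo d i) =
        bind₁ (xSubst n lo d) (pderiv (Fin.last n) (X i : MvPolynomial (Fin (n + 1)) ℚ)) := by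
      refine Fin.lastCases ?_ (fun j => ?_) i
      · simp [xSubst]
      · have hne : Fin.castSucc j ≠ Fin.last n := (Fin.castSucc_lt_last j).ne
        simp [xSubst, pderiv_X_of_ne hne]
    rw [map_mul, bind₁_X_right, pderiv_mul, hp, key, pderiv_mul, map_add, map_mul, map_mul, bind₁_X_right]

end Summit.KontsevichZagierPeriods.RootDecompRationalCubeDichotomy.RungEtale.Etale
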